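import Literature.NumberTheory.CubicFields.ThreeTorsionParametrizationIdeal
import HarnessLib

/-!
# The 3-torsion ideal class of an integer-matrix binary cubic form is an `SL₂(ℤ)`-invariant (Bhargava, HCL I, Thm 13; Bhargava–Varma, Thm 9)

Topic `Literature/NumberTheory/CubicFields`, continuing `ThreeTorsionParametrizationIdeal.lean`
(`I(C) = (θ₁, θ₂) ⊆ 𝓞 K`, `I³ = (θ₁θ₂)`, `[I]³ = 1`). Fourth step of the class-field-theory-free
road to the Davenport–Heilbronn theorem on `Cl(K)[3]` (Bhargava–Varma 2016, §§2–3).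

Bhargava, HCL I, proof of Thm 13: "changing `α, β` to some other basis for `I`, via an element
`T ∈ SL₂(ℤ)`, simply changes `C(x, y)` (via the natural `SL₂(ℤ)`-action on `Sym³ℤ²`) by that same
element `T`. Hence the `SL₂(ℤ)`-equivalence class of `C(x, y)` is independent of our choice of
basis for `I`"; and two triples `(S, I, δ)`, `(S, I', δ')` are *equivalent* when `I' = κI`,
`δ' = κ³δ`. Read in the direction form ↦ triple, with the representatives `α = θ₁, β = θ₂,
δ = θ₁θ₂` of the previous files: for `γ = (p q; r s') ∈ SL₂(ℤ)` and `C' = C ∘ γ`, putting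
`α' = pθ₁ + qθ₂`, `β' = rθ₁ + s'θ₂` (the new basis of `I`),

* `delta_mul_thetaForm_subst` — **`δ · θᵢ(C') = (α'³, α'²β', α'β'², β'³)ᵢ`**: the values of `C'`
  are those of the basis `(α', β')` (from `θ(C ∘ γ) = θ(C) ∘ γ` and the relations
  `θ₀θ₂ = θ₁², θ₁θ₃ = θ₂²`);
* `span_delta_mul_cubicIdeal_subst` — **`(δ) · I(C') = (α'β') · I(C)`** as ideals of `𝓞 K`, i.e.
  `I(C') = κ I(C)` with `κ = α'β'/δ` (and then `δ(C') = θ₁'θ₂' = κ³δ`): the triples of `C` and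
  `C'` are equivalent;
* `mk0_cubicIdeal_subst` — hence **`[I(C ∘ γ)] = [I(C)]` in `Cl(𝓞 K)`**: the 3-torsion class is a
  function of the `SL₂(ℤ)`-orbit (the map `SL₂(ℤ)\V_ℤ*(D) → Cl₃`, Bhargava–Varma Lemma 13 /
  HCL I Cor. 14–15, for the maximal order).

All statements are proved. NOT here: injectivity on orbits / surjectivity (uniqueness half of
Thm 13), the unit index and the reducible forms — the sequel files.

## References

* M. Bhargava, *Higher composition laws I*, Ann. of Math. 159 (2004), §3.4, Thm 13 and its proof
  [Bhargava2004HCL1].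
* M. Bhargava, I. Varma, *The mean number of 3-torsion elements in the class groups and ideal
  groups of quadratic orders*, Proc. LMS 112 (2016) = arXiv:1401.5875, Thm 9, Lemma 13
  [BhargavaVarma2016].
-/

namespace Literature.NumberTheory.CubicFields

open NumberField
open scoped NumberField nonZeroDivisors

namespace SymCubic

variable {K : Type*} [Field K] [CharZero K]

/-! ### The values of `C ∘ γ` are those of the basis `(α', β') = ((θ₁, θ₂)γᵀ)` -/

section Values

variable (C : SymCubic ℤ) {s : K} (hs : s ^ 2 = (C.disc : K)) (γ : Matrix (Fin 2) (Fin 2) ℤ)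
  (hγ : γ.det = 1)
include hs hγ

/-- **`δ · θ(C ∘ γ) = ((α')³, (α')²β', α'(β')², (β')³)`** with `δ = θ₁θ₂`, `α' = pθ₁ + qθ₂`,
`β' = rθ₁ + s'θ₂` for `γ = (p q; r s') ∈ SL₂(ℤ)`: the four coordinates. [cite: Bhargava2004HCL1, §3.4 (proof of Theorem 13, change of basis of I by T ∈ SL₂(ℤ))] -/
theorem delta_mul_thetaForm_subst :
    (C.thetaForm s).a₁ * (C.thetaForm s).a₂ * ((C.subst γ).thetaForm s).a₀
        = ((γ 0 0 : K) * (C.thetaForm s).a₁ + (γ 0 1 : K) * (C.thetaForm s).a₂) ^ 3 ∧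
      (C.thetaForm s).a₁ * (C.thetaForm s).a₂ * ((C.subst γ).thetaForm s).a₁
        = ((γ 0 0 : K) * (C.thetaForm s).a₁ + (γ 0 1 : K) * (C.thetaForm s).a₂) ^ 2
          * ((γ 1 0 : K) * (C.thetaForm s).a₁ + (γ 1 1 : K) * (C.thetaForm s).a₂) ∧
      (C.thetaForm s).a₁ * (C.thetaForm s).a₂ * ((C.subst γ).thetaForm s).a₂
        = ((γ 0 0 : K) * (C.thetaForm s).a₁ + (γ 0 1 : K) * (C.thetaForm s).a₂)
          * ((γ 1 0 : K) * (C.thetaForm s).a₁ + (γ 1 1 : K) * (C.thetaForm s).a₂) ^ 2 ∧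
      (C.thetaForm s).a₁ * (C.thetaForm s).a₂ * ((C.subst γ).thetaForm s).a₃
        = ((γ 1 0 : K) * (C.thetaForm s).a₁ + (γ 1 1 : K) * (C.thetaForm s).a₂) ^ 3 := by
  have h02 := thetaForm_a₀_mul_a₂ C hs
  have h13 := thetaForm_a₁_mul_a₃ C hs
  rw [thetaForm_subst C s γ hγ]
  simp only [subst, Matrix.map_apply, eq_intCast]
  refine ⟨?_, ?_, ?_, ?_⟩
  · linear_combination ((γ 0 0 : K) ^ 3 * (C.thetaForm s).a₁) * h02
      + ((γ 0 1 : K) ^ 3 * (C.thetaForm s).a₂) * h13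
  · linear_combination ((γ 0 0 : K) ^ 2 * (γ 1 0 : K) * (C.thetaForm s).a₁) * h02
      + ((γ 0 1 : K) ^ 2 * (γ 1 1 : K) * (C.thetaForm s).a₂) * h13
  · linear_combination ((γ 0 0 : K) * (γ 1 0 : K) ^ 2 * (C.thetaForm s).a₁) * h02
      + ((γ 0 1 : K) * (γ 1 1 : K) ^ 2 * (C.thetaForm s).a₂) * h13
  · linear_combination ((γ 1 0 : K) ^ 3 * (C.thetaForm s).a₁) * h02
      + ((γ 1 1 : K) ^ 3 * (C.thetaForm s).a₂) * h13

end Values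

/-! ### `(δ) · I(C ∘ γ) = (α'β') · I(C)` and the invariance of the class -/

/-- The hypotheses pass to `C ∘ γ`: `disc (C ∘ γ) = disc C` for `det γ = 1`. [folklore] -/
theorem disc_subst_of_det_eq_one {R : Type*} [CommRing R] (C : SymCubic R) (γ : Matrix (Fin 2) (Fin 2) R)
    (hγ : γ.det = 1) : (C.subst γ).disc = C.disc := by
  rw [disc_subst, hγ, one_pow, one_mul]

section Ideals

variable (C : SymCubic ℤ) {s : K} {ε : ℤ} (hs : s ^ 2 = (C.disc : K)) (hε : ε = 0 ∨ ε = 1)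
  (h4 : (4 : ℤ) ∣ C.disc - ε) (γ : Matrix (Fin 2) (Fin 2) ℤ) (hγ : γ.det = 1)
include hs hε h4 hγ

/-- **`(θ₁θ₂) · I(C ∘ γ) = (α'β') · I(C)`** in `𝓞 K`, with `α' = pθ₁ + qθ₂`, `β' = rθ₁ + s'θ₂`
(both in `I(C)`, and `(α', β')` is again a basis: `θ₁ = s'α' − qβ'`, `θ₂ = −rα' + pβ'`): the
triple of `C ∘ γ` is `(κ I, κ³ δ)`, `κ = α'β'/δ` — "equivalent" to that of `C` (HCL I, Thm 13).
Stated with integral representatives `t₁, t₂` of `θ₁, θ₂`. [cite: Bhargava2004HCL1, §3.4 (Theorem 13: equivalent triples (κI, κ³δ) and SL₂(ℤ)-orbits)] -/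
theorem span_delta_mul_cubicIdeal_subst {t₁ t₂ : 𝓞 K} (ht₁ : (t₁ : K) = (C.thetaForm s).a₁)
    (ht₂ : (t₂ : K) = (C.thetaForm s).a₂) :
    Ideal.span {t₁ * t₂} * (C.subst γ).cubicIdeal s
      = Ideal.span {((γ 0 0 : 𝓞 K) * t₁ + (γ 0 1 : 𝓞 K) * t₂) * ((γ 1 0 : 𝓞 K) * t₁ + (γ 1 1 : 𝓞 K) * t₂)}
        * C.cubicIdeal s := by
  have hs' : s ^ 2 = ((C.subst γ).disc : K) := by rw [disc_subst_of_det_eq_one C γ hγ]; exact hs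
  have h4' : (4 : ℤ) ∣ (C.subst γ).disc - ε := by rw [disc_subst_of_det_eq_one C γ hγ]; exact h4
  obtain ⟨u₀, u₁, u₂, u₃, hu₀, hu₁, hu₂, hu₃⟩ := exists_ringOfIntegers_thetaForm (C.subst γ) hs' hε h4'
  rw [cubicIdeal_eq_span (C.subst γ) hu₁ hu₂, cubicIdeal_eq_span C ht₁ ht₂]
  obtain ⟨-, e1, e2, -⟩ := delta_mul_thetaForm_subst C hs γ hγ
  set a' : 𝓞 K := (γ 0 0 : 𝓞 K) * t₁ + (γ 0 1 : 𝓞 K) * t₂ with ha'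
  set b' : 𝓞 K := (γ 1 0 : 𝓞 K) * t₁ + (γ 1 1 : 𝓞 K) * t₂ with hb'
  have ha'K : (a' : K) = (γ 0 0 : K) * (C.thetaForm s).a₁ + (γ 0 1 : K) * (C.thetaForm s).a₂ := by
    simp only [ha', map_add, map_mul, map_intCast, ← ht₁, ← ht₂]
  have hb'K : (b' : K) = (γ 1 0 : K) * (C.thetaForm s).a₁ + (γ 1 1 : K) * (C.thetaForm s).a₂ := by
    simp only [hb', map_add, map_mul, map_intCast, ← ht₁, ← ht₂]
  -- the two relations in `𝓞 K`
  have r1 : t₁ * t₂ * u₁ = a' ^ 2 * b' := by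
    apply RingOfIntegers.coe_injective
    simp only [map_pow, map_mul]
    rw [← RingOfIntegers.coe_eq_algebraMap t₁, ← RingOfIntegers.coe_eq_algebraMap t₂,
      ← RingOfIntegers.coe_eq_algebraMap u₁, ← RingOfIntegers.coe_eq_algebraMap a',
      ← RingOfIntegers.coe_eq_algebraMap b', ht₁, ht₂, hu₁, ha'K, hb'K]
    exact e1
  have r2 : t₁ * t₂ * u₂ = a' * b' ^ 2 := by
    apply RingOfIntegers.coe_injective
    simp only [map_pow, map_mul]
    rw [← RingOfIntegers.coe_eq_algebraMap t₁, ← RingOfIntegers.coe_eq_algebraMap t₂,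
      ← RingOfIntegers.coe_eq_algebraMap u₂, ← RingOfIntegers.coe_eq_algebraMap a',
      ← RingOfIntegers.coe_eq_algebraMap b', ht₁, ht₂, hu₂, ha'K, hb'K]
    exact e2
  -- unimodularity: `t₁ = s' a' − q b'`, `t₂ = −r a' + p b'`
  have hdet : (γ 0 0 : 𝓞 K) * (γ 1 1 : 𝓞 K) - (γ 0 1 : 𝓞 K) * (γ 1 0 : 𝓞 K) = 1 := by
    have := congrArg (Int.cast : ℤ → 𝓞 K) hγ
    rw [Matrix.det_fin_two] at this
    push_cast at this
    exact this
  have ht₁' : t₁ = (γ 1 1 : 𝓞 K) * a' - (γ 0 1 : 𝓞 K) * b' := by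
    rw [ha', hb']; linear_combination (-t₁) * hdet
  have ht₂' : t₂ = -(γ 1 0 : 𝓞 K) * a' + (γ 0 0 : 𝓞 K) * b' := by
    rw [ha', hb']; linear_combination (-t₂) * hdet
  have ma' : a' ∈ Ideal.span ({t₁, t₂} : Set (𝓞 K)) :=
    Ideal.add_mem _ (Ideal.mul_mem_left _ _ (Ideal.subset_span (by simp)))
      (Ideal.mul_mem_left _ _ (Ideal.subset_span (by simp)))
  have mb' : b' ∈ Ideal.span ({t₁, t₂} : Set (𝓞 K)) :=
    Ideal.add_mem _ (Ideal.mul_mem_left _ _ (Ideal.subset_span (by simp)))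
      (Ideal.mul_mem_left _ _ (Ideal.subset_span (by simp)))
  have mu₁ : u₁ ∈ Ideal.span ({u₁, u₂} : Set (𝓞 K)) := Ideal.subset_span (by simp)
  have mu₂ : u₂ ∈ Ideal.span ({u₁, u₂} : Set (𝓞 K)) := Ideal.subset_span (by simp)
  apply le_antisymm
  · refine Ideal.mul_le.mpr fun x hx y hy => ?_
    rw [Ideal.mem_span_singleton] at hx
    obtain ⟨c, rfl⟩ := hx
    rw [Ideal.mem_span_pair] at hy
    obtain ⟨u, v, rfl⟩ := hy
    have key : t₁ * t₂ * c * (u * u₁ + v * u₂) = (a' * b') * (c * (u * a' + v * b')) := by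
      linear_combination (c * u) * r1 + (c * v) * r2
    rw [key]
    exact Ideal.mul_mem_mul (Ideal.mem_span_singleton_self _)
      (Ideal.mul_mem_left _ _ (Ideal.add_mem _ (Ideal.mul_mem_left _ _ ma') (Ideal.mul_mem_left _ _ mb')))
  · refine Ideal.mul_le.mpr fun x hx y hy => ?_
    rw [Ideal.mem_span_singleton] at hx
    obtain ⟨c, rfl⟩ := hx
    rw [Ideal.mem_span_pair] at hy
    obtain ⟨u, v, rfl⟩ := hy
    have key : a' * b' * c * (u * t₁ + v * t₂)
        = (t₁ * t₂) * (c * ((u * (γ 1 1 : 𝓞 K) - v * (γ 1 0 : 𝓞 K)) * u₁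
            + (v * (γ 0 0 : 𝓞 K) - u * (γ 0 1 : 𝓞 K)) * u₂)) := by
      linear_combination (-(c * (u * (γ 1 1 : 𝓞 K) - v * (γ 1 0 : 𝓞 K)))) * r1
        - (c * (v * (γ 0 0 : 𝓞 K) - u * (γ 0 1 : 𝓞 K))) * r2
        + (a' * b' * c * u) * ht₁' + (a' * b' * c * v) * ht₂'
    rw [key]
    exact Ideal.mul_mem_mul (Ideal.mem_span_singleton_self _)
      (Ideal.mul_mem_left _ _ (Ideal.add_mem _ (Ideal.mul_mem_left _ _ mu₁) (Ideal.mul_mem_left _ _ mu₂)))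

omit hε h4 in
/-- `α' ≠ 0` and `β' ≠ 0` when `disc C` is not a square (`(α')³ = δθ₀(C∘γ) ≠ 0`). [folklore] -/
theorem basisChange_ne_zero (hD : ¬ IsSquare C.disc) :
    (γ 0 0 : K) * (C.thetaForm s).a₁ + (γ 0 1 : K) * (C.thetaForm s).a₂ ≠ 0 ∧
      (γ 1 0 : K) * (C.thetaForm s).a₁ + (γ 1 1 : K) * (C.thetaForm s).a₂ ≠ 0 := by
  have hs' : s ^ 2 = ((C.subst γ).disc : K) := by rw [disc_subst_of_det_eq_one C γ hγ]; exact hs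
  have hD' : ¬ IsSquare (C.subst γ).disc := by rw [disc_subst_of_det_eq_one C γ hγ]; exact hD
  obtain ⟨e0, -, -, e3⟩ := delta_mul_thetaForm_subst C hs γ hγ
  have hδ := thetaForm_a₁_mul_a₂_ne_zero C hs hD
  constructor
  · intro h
    rw [h, zero_pow three_ne_zero] at e0
    exact (mul_ne_zero hδ (thetaForm_a₀_ne_zero (C.subst γ) hs' hD')) e0
  · intro h
    rw [h, zero_pow three_ne_zero] at e3
    exact (mul_ne_zero hδ (thetaForm_a₃_ne_zero (C.subst γ) hs' hD')) e3

/-- **The 3-torsion class is an `SL₂(ℤ)`-invariant**: `[I(C ∘ γ)] = [I(C)]` in `Cl(𝓞 K)` for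
`γ ∈ SL₂(ℤ)` and every `C` of non-square discriminant (the ideals differ by the principal factor
`κ = α'β'/δ`; Mathlib's `ClassGroup.mk0_eq_mk0_iff`). So `C ↦ [I(C)]`
descends to `SL₂(ℤ)\{C : disc C = D} → Cl(𝓞 K)[3]` (Bhargava–Varma Lemma 13's `H(𝒪) → Cl₃(𝒪)`
composed with Thm 9, `𝒪 = 𝓞 K`). [cite: BhargavaVarma2016, Theorem 9 and Lemma 13 (SL₂(ℤ)-orbits ↦ 3-torsion ideal classes)] -/
theorem mk0_cubicIdeal_subst [NumberField K] (hD : ¬ IsSquare C.disc) :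
    ClassGroup.mk0 ⟨(C.subst γ).cubicIdeal s, mem_nonZeroDivisors_of_ne_zero
        (cubicIdeal_ne_bot (C.subst γ) (by rw [disc_subst_of_det_eq_one C γ hγ]; exact hs) hε
          (by rw [disc_subst_of_det_eq_one C γ hγ]; exact h4)
          (by rw [disc_subst_of_det_eq_one C γ hγ]; exact hD))⟩
      = ClassGroup.mk0 ⟨C.cubicIdeal s, mem_nonZeroDivisors_of_ne_zero (cubicIdeal_ne_bot C hs hε h4 hD)⟩ := by
  obtain ⟨t₀, t₁, t₂, t₃, ht₀, ht₁, ht₂, ht₃⟩ := exists_ringOfIntegers_thetaForm C hs hε h4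
  rw [ClassGroup.mk0_eq_mk0_iff]
  obtain ⟨hα, hβ⟩ := basisChange_ne_zero C hs γ hγ hD
  refine ⟨t₁ * t₂, ((γ 0 0 : 𝓞 K) * t₁ + (γ 0 1 : 𝓞 K) * t₂) * ((γ 1 0 : 𝓞 K) * t₁ + (γ 1 1 : 𝓞 K) * t₂),
    ?_, ?_, span_delta_mul_cubicIdeal_subst C hs hε h4 γ hγ ht₁ ht₂⟩
  · intro h
    have : (C.thetaForm s).a₁ * (C.thetaForm s).a₂ = 0 := by
      rw [← ht₁, ← ht₂, ← map_mul, h]; rfl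
    exact thetaForm_a₁_mul_a₂_ne_zero C hs hD this
  · refine mul_ne_zero ?_ ?_
    · intro h
      apply hα
      have := congrArg (algebraMap (𝓞 K) K) h
      simp only [map_add, map_mul, map_intCast, map_zero] at this
      rw [← RingOfIntegers.coe_eq_algebraMap t₁, ← RingOfIntegers.coe_eq_algebraMap t₂, ht₁, ht₂] at this
      exact this
    · intro h
      apply hβ
      have := congrArg (algebraMap (𝓞 K) K) h
      simp only [map_add, map_mul, map_intCast, map_zero] at this
      rw [← RingOfIntegers.coe_eq_algebraMap t₁, ← RingOfIntegers.coe_eq_algebraMap t₂, ht₁, ht₂] at this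
      exact this

end Ideals

end SymCubic

end Literature.NumberTheory.CubicFields
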